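import Summits.KontsevichZagierPeriods.KontsevichZagierPeriods.Theorems.LinRedNormalFormHoffmanIndependenceSplit
import Literature.NumberTheory.Transcendental.BrownMotivicMZVExistence

/-!
# Crux `HoffmanIndependence` (stmt-KontsevichZagierPeriods-15045), line `weight_split` —
# the crux against Zagier's conjecture: what it proves, what proves it, and when they coincide

The crux `Theses.LinRedNormalForm.HoffmanIndependence` (`ℚ`-linear independence of ALL real Hoffman
values `ζ(u)`, `u ∈ {2,3}^×`) is filed as a "declared transcendence input, equivalent to Zagier's
conjecture given Brown's theorem". This file makes that sentence a set of Lean theorems over the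
Literature conjectures `ZagierDimensionConjecture` (`∀ n, dim_ℚ 𝒵_n = d_n`),
`MZVWeightGradingConjecture` (`iSupIndep mzvSpace`) and `ZagierConjecture` (their conjunction),
the named facts `hoffmanSpan_eq_mzvSpace` (Brown 2012, Thm. 1.1), `finrank_mzvSpace_le_zagierDim`
(Terasoma 2002 / Deligne–Goncharov 2005) and `Brown2012.motivicMZV_nonempty` (existence of Brown's
motivic package, to which the tree reduces both named facts):

* UNCONDITIONALLY the crux proves the HARD HALF of Zagier's dimension conjecture for the full MZV
  spaces: `zagierDim_le_finrank_mzvSpace_of_hoffmanIndependence : HoffmanIndependence → ∀ n, d_n ≤ dim_ℚ 𝒵_n`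
  (the `d_n` Hoffman values of weight `n` are independent elements of `𝒵_n`); hence
  `HoffmanIndependence → finrank_mzvSpace_le_zagierDim → ZagierDimensionConjecture`, and in weights
  `n ≤ 9`, where the upper bound is a tree theorem, `HoffmanIndependence → dim_ℚ 𝒵_n = d_n` outright.
* Given Brown's theorem the crux IS Zagier's conjecture:
  `hoffmanIndependence_iff_zagierConjecture : hoffmanSpan_eq_mzvSpace → (HoffmanIndependence ↔ ZagierConjecture)`,
  and the same from `Brown2012.motivicMZV_nonempty`
  (`hoffmanIndependence_iff_zagierConjecture_of_motivicMZV`).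
* The in-weight stub of the line, slice by slice, against the dimension conjecture: for `n ≤ 9`
  (Brown's theorem is elementary and proved in the tree there) the weight-`n` slice of
  `stub_inWeight` is EXACTLY `dim_ℚ 𝒵_n = d_n` (`inWeight_iff_finrank_mzvSpace_eq_of_le_nine`), and
  in the tree's classical coordinates of `𝒵₇, 𝒵₈, 𝒵₉`:
  slice 7 ⟺ `ζ(7), π²ζ(5), π⁴ζ(3)` independent; slice 8 ⟺ `ζ(6,2), π⁸, π²ζ(3)², ζ(3)ζ(5)`
  independent; slice 9 ⟺ `ζ(9), π²ζ(7), π⁴ζ(5), π⁶ζ(3), ζ(3)³` independent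
  (`inWeight_seven_iff`, `inWeight_eight_iff`, `inWeight_nine_iff`; slices 5, 6 are
  `inWeight_five_iff`, `inWeight_six_iff` of the Rungs files). For every `n`, a slice gives
  Zagier's lower bound in that weight (`zagierDim_le_finrank_mzvSpace_of_inWeight`).

Nothing here closes the item (both directions of the equivalence keep the crux open-problem
grade); no new definitions. [cite: Zagier1994, §9] [cite: GoncharovECM2001, Conjecture 1.1]
[cite: Brown2012, Theorem 1.1] [cite: Terasoma2002, Theorem 1.2]
-/

noncomputable section

namespace Summit.KontsevichZagierPeriods.LinRedNormalForm.HoffmanIndependence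

open Literature.NumberTheory.Transcendental MZV
open Summit.KontsevichZagierPeriods.KontsevichZagierPeriods.Theses.LinRedNormalForm (HoffmanIndependence)

/-! ## What the crux proves unconditionally: Zagier's lower bound for the full MZV spaces -/

/-- Under the crux the Hoffman span of weight `n` has dimension exactly `d_n` (its `d_n` generators
are independent). [cite: Zagier1994, §9] -/
theorem finrank_hoffmanSpan_eq_of_hoffmanIndependence (h : HoffmanIndependence) (n : ℕ) :
    Module.finrank ℚ (hoffmanSpan n) = zagierDim n :=
  inWeight_iff_finrank_eq.1 (inWeight_of_hoffmanIndependence h) n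

/-- A single in-weight slice already gives Zagier's LOWER bound in that weight for the full MZV
space: `d_n ≤ dim_ℚ 𝒵_n` (the Hoffman span sits inside `𝒵_n`, which is finite-dimensional).
[cite: Zagier1994, §9] -/
theorem zagierDim_le_finrank_mzvSpace_of_inWeight {n : ℕ}
    (h : LinearIndependent ℚ
      (fun u : {u : List ℕ // IsHoffman u ∧ weight u = n} => multipleZeta u.1)) :
    zagierDim n ≤ Module.finrank ℚ (mzvSpace n) :=
  ((inWeight_iff_zagierDim_le_finrank n).1 h).trans
    (Submodule.finrank_mono (hoffmanSpan_le_mzvSpace n))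

/-- **The crux proves the hard half of Zagier's dimension conjecture, unconditionally**:
`HoffmanIndependence → ∀ n, d_n ≤ dim_ℚ 𝒵_n` (no Brown, no Terasoma needed: the `d_n` real Hoffman
values of weight `n` are `ℚ`-linearly independent members of `𝒵_n`). Already `n = 5` of the
conclusion (`2 ≤ dim_ℚ 𝒵₅`, i.e. `ζ(5) ∉ ℚζ(2)ζ(3)`) is open. [cite: Zagier1994, §9] -/
theorem zagierDim_le_finrank_mzvSpace_of_hoffmanIndependence (h : HoffmanIndependence) (n : ℕ) :
    zagierDim n ≤ Module.finrank ℚ (mzvSpace n) :=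
  zagierDim_le_finrank_mzvSpace_of_inWeight (inWeight_of_hoffmanIndependence h n)

/-- **Crux + the Terasoma–Deligne–Goncharov upper bound ⇒ Zagier's dimension conjecture.**
[cite: Zagier1994, §9] [cite: Terasoma2002, Theorem 1.2] -/
theorem zagierDimensionConjecture_of_hoffmanIndependence (h : HoffmanIndependence)
    (hT : finrank_mzvSpace_le_zagierDim) : ZagierDimensionConjecture :=
  fun n => le_antisymm (hT n) (zagierDim_le_finrank_mzvSpace_of_hoffmanIndependence h n)

/-- In weights `n ≤ 9` the upper bound is a tree theorem (`finrank_mzvSpace_le_zagierDim_of_le_nine`),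
so there the crux gives `dim_ℚ 𝒵_n = d_n` outright. [cite: Zagier1994, §9] -/
theorem finrank_mzvSpace_eq_of_hoffmanIndependence_of_le_nine (h : HoffmanIndependence) {n : ℕ}
    (hn : n ≤ 9) : Module.finrank ℚ (mzvSpace n) = zagierDim n :=
  le_antisymm (finrank_mzvSpace_le_zagierDim_of_le_nine hn)
    (zagierDim_le_finrank_mzvSpace_of_hoffmanIndependence h n)

/-! ## Given Brown's theorem the crux IS Zagier's conjecture -/

/-- Crux + Brown ⇒ Goncharov's weight-grading conjecture for the full MZV spaces.
[cite: GoncharovECM2001, Conjecture 1.1] [cite: Brown2012, Theorem 1.1] -/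
theorem gradingConjecture_of_hoffmanIndependence (h : HoffmanIndependence)
    (hB : hoffmanSpan_eq_mzvSpace) : MZVWeightGradingConjecture :=
  (weightGrading_iff_gradingConjecture hB).1 (weightGrading_of_hoffmanIndependence h)

/-- **Crux + Brown ⇒ Zagier's conjecture** (dimension conjecture ∧ weight grading): the upper
bound `dim_ℚ 𝒵_n ≤ d_n` is itself a consequence of Brown's theorem
(`finrank_mzvSpace_le_zagierDim_of_hoffmanSpan_eq`). [cite: Zagier1994, §9] [cite: Brown2012, Theorem 1.1] -/
theorem zagierConjecture_of_hoffmanIndependence (h : HoffmanIndependence)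
    (hB : hoffmanSpan_eq_mzvSpace) : ZagierConjecture :=
  ⟨zagierDimensionConjecture_of_hoffmanIndependence h
      (finrank_mzvSpace_le_zagierDim_of_hoffmanSpan_eq hB),
    gradingConjecture_of_hoffmanIndependence h hB⟩

/-- **THE CRUX IS ZAGIER'S CONJECTURE, given Brown's theorem.** Under the named fact
`hoffmanSpan_eq_mzvSpace` (Brown 2012, Thm. 1.1: the Hoffman values span the MZVs weight by
weight), `HoffmanIndependence ↔ ZagierConjecture` (`= ZagierDimensionConjecture ∧
MZVWeightGradingConjecture`, Zagier 1994 §9 / Goncharov ECM 2000 Conj. 1.1): `→` by the two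
theorems above, `←` is `hoffmanIndependence_of_zagier_goncharov_brown`. This is the precise sense
in which the item is "open-problem grade": it is the period conjecture for `MT(ℤ)` on MZVs in
Brown's basis. [cite: Zagier1994, §9] [cite: GoncharovECM2001, Conjecture 1.1] [cite: Brown2012, Theorem 1.1] -/
theorem hoffmanIndependence_iff_zagierConjecture :
    hoffmanSpan_eq_mzvSpace → (HoffmanIndependence ↔ ZagierConjecture) := fun hB =>
  ⟨fun h => zagierConjecture_of_hoffmanIndependence h hB,
    fun hZ => hoffmanIndependence_of_zagier_goncharov_brown hZ.2 hZ.1 hB⟩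

/-- The same equivalence from the existence of Brown's motivic MZV package
(`Brown2012.motivicMZV_nonempty`, the XL named fact to which the tree reduces Brown's theorem:
`hoffmanSpan_eq_mzvSpace_of_motivicMZV_nonempty`). [cite: Brown2012, Theorem 1.1] -/
theorem hoffmanIndependence_iff_zagierConjecture_of_motivicMZV
    (hM : Brown2012.motivicMZV_nonempty) : HoffmanIndependence ↔ ZagierConjecture :=
  hoffmanIndependence_iff_zagierConjecture (hoffmanSpan_eq_mzvSpace_of_motivicMZV_nonempty hM)

/-- Without any spanning input, the two printed conjectures and the crux are sandwiched as
follows: `ZagierConjecture ∧ Brown ⇒ crux ⇒ (grading of the Hoffman spans) ∧ (∀ n, d_n ≤ dim_ℚ 𝒵_n)`.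
This is the lower slice of the sandwich. [cite: Zagier1994, §9] -/
theorem weightGrading_and_lowerBound_of_hoffmanIndependence (h : HoffmanIndependence) :
    iSupIndep hoffmanSpan ∧ ∀ n : ℕ, zagierDim n ≤ Module.finrank ℚ (mzvSpace n) :=
  ⟨weightGrading_of_hoffmanIndependence h, zagierDim_le_finrank_mzvSpace_of_hoffmanIndependence h⟩

/-! ## The in-weight stub against the dimension conjecture, slice by slice -/

/-- If Brown's theorem holds in weight `n`, the weight-`n` slice of `stub_inWeight` is EXACTLY
`dim_ℚ 𝒵_n = d_n` (upper bound: `𝒵_n` is then spanned by `d_n` vectors). [cite: Zagier1994, §9] -/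
theorem inWeight_iff_finrank_mzvSpace_eq_of_hoffmanSpan_eq {n : ℕ}
    (hB : hoffmanSpan n = mzvSpace n) :
    LinearIndependent ℚ
        (fun u : {u : List ℕ // IsHoffman u ∧ weight u = n} => multipleZeta u.1) ↔
      Module.finrank ℚ (mzvSpace n) = zagierDim n := by
  rw [inWeight_iff_zagierDim_le_finrank, hB]
  have hle : Module.finrank ℚ (mzvSpace n) ≤ zagierDim n := by
    rw [← hB]
    exact finrank_hoffmanSpan_le_zagierDim n
  exact ⟨fun h => le_antisymm hle h, fun h => h.ge⟩

/-- **Slices `n ≤ 9` of `stub_inWeight` are exactly Zagier's dimension conjecture in weight `n`**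
(Brown's theorem is a tree theorem in weights `≤ 9`, `hoffmanSpan_eq_mzvSpace_of_le_nine`): no
motivic input is involved below weight `10`. Slices `n ≤ 4` hold (`inWeight_of_le_four`); slices
`5, …, 9` are the open statements `dim_ℚ 𝒵₅ = 2`, `dim_ℚ 𝒵₆ = 2`, `dim_ℚ 𝒵₇ = 3`, `dim_ℚ 𝒵₈ = 4`,
`dim_ℚ 𝒵₉ = 5`. [cite: Zagier1994, §9] -/
theorem inWeight_iff_finrank_mzvSpace_eq_of_le_nine {n : ℕ} (hn : n ≤ 9) :
    LinearIndependent ℚ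
        (fun u : {u : List ℕ // IsHoffman u ∧ weight u = n} => multipleZeta u.1) ↔
      Module.finrank ℚ (mzvSpace n) = zagierDim n :=
  inWeight_iff_finrank_mzvSpace_eq_of_hoffmanSpan_eq (hoffmanSpan_eq_mzvSpace_of_le_nine hn)

/-- Given Brown's theorem, `stub_inWeight` as a whole IS Zagier's dimension conjecture.
[cite: Zagier1994, §9] [cite: Brown2012, Theorem 1.1] -/
theorem inWeight_iff_zagierDimensionConjecture (hB : hoffmanSpan_eq_mzvSpace) :
    (∀ n : ℕ, LinearIndependent ℚ
        (fun u : {u : List ℕ // IsHoffman u ∧ weight u = n} => multipleZeta u.1)) ↔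
      ZagierDimensionConjecture :=
  forall_congr' fun n => inWeight_iff_finrank_mzvSpace_eq_of_hoffmanSpan_eq (hB n)

/-! ## Slices 7, 8, 9 in classical coordinates -/

/-- Dimension test for an explicitly spanned subspace: `d` vectors spanning `V` are independent iff
`d ≤ dim_ℚ V`. [folklore] -/
theorem linearIndependent_iff_le_finrank_of_eq_span {d : ℕ} {v : Fin d → ℝ} {V : Submodule ℚ ℝ}
    (hV : V = Submodule.span ℚ (Set.range v)) :
    LinearIndependent ℚ v ↔ d ≤ Module.finrank ℚ V := by
  rw [linearIndependent_iff_card_le_finrank_span, Fintype.card_fin, hV]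
  rfl

/-- Transport of a slice to explicit coordinates: if the weight-`n` Hoffman span is spanned by `d_n`
explicit real numbers `v₀, …, v_{d - 1}` with `d = d_n`, the weight-`n` slice of `stub_inWeight`
holds iff the `vᵢ` are `ℚ`-linearly independent. [folklore] -/
theorem inWeight_iff_linearIndependent_of_eq_span {n d : ℕ} (hd : zagierDim n = d)
    {v : Fin d → ℝ} (hV : hoffmanSpan n = Submodule.span ℚ (Set.range v)) :
    LinearIndependent ℚ
        (fun u : {u : List ℕ // IsHoffman u ∧ weight u = n} => multipleZeta u.1) ↔
      LinearIndependent ℚ v := by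
  rw [inWeight_iff_zagierDim_le_finrank, linearIndependent_iff_le_finrank_of_eq_span hV, hd]

/-- **Slice 7 of `stub_inWeight`, typed**: the three weight-7 Hoffman values
`ζ(3,2,2), ζ(2,3,2), ζ(2,2,3)` are independent iff `ζ(7), π²ζ(5), π⁴ζ(3)` are `ℚ`-linearly
independent (`𝒵₇ = ℚζ(7) + ℚπ²ζ(5) + ℚπ⁴ζ(3)`, tree theorem `mzvSpace_seven_eq_span`), i.e. iff
`dim_ℚ 𝒵₇ = 3`. Open. [cite: Zagier1994, §9] -/
theorem inWeight_seven_iff :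
    LinearIndependent ℚ
        (fun u : {u : List ℕ // IsHoffman u ∧ weight u = 7} => multipleZeta u.1) ↔
      LinearIndependent ℚ
        ![multipleZeta [7], Real.pi ^ 2 * multipleZeta [5], Real.pi ^ 4 * multipleZeta [3]] := by
  refine inWeight_iff_linearIndependent_of_eq_span (n := 7) (d := 3) (by decide) ?_
  rw [hoffmanSpan_seven_eq, mzvSpace_seven_eq_span]
  congr 1
  rw [Matrix.range_cons, Matrix.range_cons, Matrix.range_cons_empty, Set.singleton_union, Set.singleton_union]

/-- **Slice 8 of `stub_inWeight`, typed**: the four weight-8 Hoffman values are independent iff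
`ζ(6,2), π⁸, π²ζ(3)², ζ(3)ζ(5)` are `ℚ`-linearly independent (`mzvSpace_eight_eq_span`), i.e. iff
`dim_ℚ 𝒵₈ = 4`. Open. [cite: Zagier1994, §9] -/
theorem inWeight_eight_iff :
    LinearIndependent ℚ
        (fun u : {u : List ℕ // IsHoffman u ∧ weight u = 8} => multipleZeta u.1) ↔
      LinearIndependent ℚ
        ![multipleZeta [6, 2], Real.pi ^ 8, Real.pi ^ 2 * multipleZeta [3] ^ 2,
          multipleZeta [3] * multipleZeta [5]] := by
  refine inWeight_iff_linearIndependent_of_eq_span (n := 8) (d := 4) (by decide) ?_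
  rw [hoffmanSpan_eight_eq, mzvSpace_eight_eq_span]
  congr 1
  rw [Matrix.range_cons, Matrix.range_cons, Matrix.range_cons, Matrix.range_cons_empty, Set.singleton_union, Set.singleton_union, Set.singleton_union]

/-- **Slice 9 of `stub_inWeight`, typed**: the five weight-9 Hoffman values are independent iff
`ζ(9), π²ζ(7), π⁴ζ(5), π⁶ζ(3), ζ(3)³` are `ℚ`-linearly independent (`mzvSpace_nine_eq_span`), i.e.
iff `dim_ℚ 𝒵₉ = 5`. Open. [cite: Zagier1994, §9] -/
theorem inWeight_nine_iff :
    LinearIndependent ℚ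
        (fun u : {u : List ℕ // IsHoffman u ∧ weight u = 9} => multipleZeta u.1) ↔
      LinearIndependent ℚ
        ![multipleZeta [9], Real.pi ^ 2 * multipleZeta [7], Real.pi ^ 4 * multipleZeta [5],
          Real.pi ^ 6 * multipleZeta [3], multipleZeta [3] ^ 3] := by
  refine inWeight_iff_linearIndependent_of_eq_span (n := 9) (d := 5) (by decide) ?_
  rw [hoffmanSpan_nine_eq, mzvSpace_nine_eq_span]
  congr 1
  rw [Matrix.range_cons, Matrix.range_cons, Matrix.range_cons, Matrix.range_cons, Matrix.range_cons_empty, Set.singleton_union, Set.singleton_union, Set.singleton_union, Set.singleton_union]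

end Summit.KontsevichZagierPeriods.LinRedNormalForm.HoffmanIndependence
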